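import Mathlib
import HarnessLib
import Summits.Ventures.LatticeQCDFlow.Scaling.AutoregressiveGaugeHeatBathVolumeFloor
import Summits.Ventures.LatticeQCDFlow.Scaling.TorusClosingSection
import Summits.Ventures.LatticeQCDFlow.Exactness.Phi4FlowSamplerSticking

/-!
# LatticeQCDFlow / Scaling — THE VOLUME LAW of exact one-plaquette heat-bath autoregression: in every
# `d ≥ 3` the optimal exact sampler freezes at the cold configuration for `≳ (M/M₂)^{k_min/(2d−3)}` steps
# and has an observable with `τ_int` of that order — exponential in `L^d`

HONEST FRAMING: exact (Metropolis-corrected) sampling algorithms for lattice gauge theory;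
figures of merit are autocorrelation/cost numbers at stated couplings and volumes; no
continuum-physics claim.

Venture `LatticeQCDFlow` (cell pub-lqcd), topic `Scaling`, FANOUT row 30 (lean-1, GEN-26) — OUR WORK on
THEORY-2.md §4 row C5, assembling the lower half of the volume law.  GEN-24/25 settled the STATIC
question — the least number of plaquettes of `(ℤ/L)^d` outside an exact one-plaquette heat-bath
autoregression is `k_min(d, L) = (d−1)(d−2)/2·L^d + (d−1)` (`TorusRankedMorseCount`) — and the CEILING
of the exact sampler built on it: acceptance `≥ (m/M)^{k_min}` pointwise and `τ_int ≤ (M/m)^{k_min} − 1/2`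
for every bounded observable (`AutoregressiveGaugeHeatBathOptimal`), leaving open whether the
sampler actually slows down with the volume in `d ≥ 3`.  It does, for every weight whose two-plaquette
constant `M₂` (`∫ w(h) w(a h^{±1} b) dHaar ≤ c·M₂`, `Scaling/PlaquetteSharedLinkPeeling`) is `< M = w(1)`:

* §1 **`closing_coldStart_frozen`** — for a ranked structure with a closing section of size `s`, the exact
  sampler started AT the cold configuration `U ≡ 1` is still there after `t` steps with probability
  `≥ (1 − (M₂/M)^s)^t` (row 2's holding bound `indepMH_iterate_dirac_singleton_real_ge_pow` with the
  acceptance bound of `Scaling/AutoregressiveGaugeHeatBathVolumeFloor`);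
* §2 **`exists_optimal_volumeFloor`** — every `(ℤ/L)^d` (`L ≥ 2`) carries an OPTIMAL ranked structure
  (`#Bᶜ = k_min(d, L)`) with a closing section of size `s`, `k_min ≤ (2(d−1) − 1)·s`
  (`Scaling/TorusClosingSection`), whose exact block sampler therefore has acceptance mass
  `≤ (M₂/M)^s·M^{k_min}/F_R(U)` from every `U` and, for every event `A ⊆ {F_R > θ M^{k_min}}` of positive
  target probability, `τ_int(1_A − π(A)) ≥ 1/(π(A) + (M₂/M)^s/θ) − 1/2`;
  **`exists_optimal_volumeFloor_three`** — `d = 3`: `k_min = L³ + 2 ≤ 3s`, so the floor is of order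
  `(M/M₂)^{(L³+2)/3}` against the ceiling `(M/m)^{L³+2} − 1/2`: BOTH SIDES EXPONENTIAL IN THE VOLUME.
  (In `d = 2`, `k = s = 1`: `M/M₂` vs `M/m`, volume-independent — the comb sampler of GEN-24.)

NOT CLAIMED: slowness of smooth observables in stationarity (the certified slow event sits at the cold
configuration, whose target probability is small — the sequel sends it to `0` with `θ ↑ 1` when
`Haar{w = M} = 0`); any value of `M₂` (a one-plaquette integral: `I₀(2β)/(I₀(β) e^β) → 2^{−1/2}` for
`U(1)` Wilson weights is a remark, not a theorem here).  No `def`, no `sorry`, nothing cited as a fact.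
-/

noncomputable section

namespace Summit.Ventures.LatticeQCDFlow.Theory2.Autoregressive

open MeasureTheory ProbabilityTheory Function Finset
open Summit.Ventures.LatticeQCDFlow.Exactness Summit.Ventures.LatticeQCDFlow.Scoring
open Literature.MathematicalPhysics.QuantumFieldTheory Literature.MathematicalPhysics.QuantumLattice
open scoped ENNReal

variable {d L : ℕ} [NeZero L] {G : Type*} [Group G] [TopologicalSpace G] [IsTopologicalGroup G]
  [CompactSpace G] [SecondCountableTopology G] [MeasurableSpace G] [BorelSpace G]

/-! ## §1 The cold start freezes -/

/-- **THE COLD START FREEZES.**  Setting of `closing_volumeFloor` (`L ≥ 2`; `0 < m ≤ w ≤ M`, `w`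
continuous with `w(1) = M`; two-plaquette constant `M₂`; `(B, t, rank)` ranked with a closing section
`(S, u)` of size `s`; `q` the block proposal, `K = indepMH q (Z_B F_R/Z)` the exact sampler), singletons
of `G` measurable.  Started AT the cold configuration `U ≡ 1` the chain is still there after `t` steps
with probability at least `(1 − (M₂/M)^s)^t`: it takes `≳ (M/M₂)^s` steps to leave. [ours] -/
theorem closing_coldStart_frozen [MeasurableSingletonClass G] (hL : 2 ≤ L) {w : G → ℝ}
    (hw : Continuous w) {m M : ℝ} (hm0 : 0 < m) (hm : ∀ g, m ≤ w g) (hM : ∀ g, w g ≤ M) (hw1 : w 1 = M)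
    {M₂ : ℝ}
    (hM₂ : ∀ a b : G, ∫ h, w h * w (a * h * b) ∂(haarProbability G) ≤
      (∫ g, w g ∂(haarProbability G)) * M₂)
    (hM₂' : ∀ a b : G, ∫ h, w h * w (a * h⁻¹ * b) ∂(haarProbability G) ≤
      (∫ g, w g ∂(haarProbability G)) * M₂)
    (hM₂M : M₂ ≤ M)
    (B : Finset (Plaquette d L)) (t : Plaquette d L → Edge d L)
    (ht : ∀ p ∈ B, t p ∈ ({(p.1, p.2.1.1), (p.1.shift p.2.1.1, p.2.1.2),
        (p.1.shift p.2.1.2, p.2.1.1), (p.1, p.2.1.2)} : Finset (Edge d L)))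
    (rank : Plaquette d L → ℕ)
    (hrank : ∀ p ∈ B, ∀ p' ∈ B, p ≠ p' → t p ∈ ({(p'.1, p'.2.1.1), (p'.1.shift p'.2.1.1, p'.2.1.2),
        (p'.1.shift p'.2.1.2, p'.2.1.1), (p'.1, p'.2.1.2)} : Finset (Edge d L)) → rank p < rank p')
    (S : Finset (Plaquette d L)) (u : Plaquette d L → Plaquette d L) (hSB : ∀ p' ∈ S, p' ∉ B)
    (huB : ∀ p' ∈ S, u p' ∈ B)
    (hut : ∀ p' ∈ S, t (u p') ∈ ({(p'.1, p'.2.1.1), (p'.1.shift p'.2.1.1, p'.2.1.2),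
        (p'.1.shift p'.2.1.2, p'.2.1.1), (p'.1, p'.2.1.2)} : Finset (Edge d L)))
    (humax : ∀ p' ∈ S, ∀ p ∈ B, p ≠ u p' → t p ∈ ({(p'.1, p'.2.1.1), (p'.1.shift p'.2.1.1, p'.2.1.2),
        (p'.1.shift p'.2.1.2, p'.2.1.1), (p'.1, p'.2.1.2)} : Finset (Edge d L)) → rank p < rank (u p'))
    (huinj : Set.InjOn u S)
    (π q : Measure (GaugeConfig d L G)) [IsProbabilityMeasure π] [IsProbabilityMeasure q]
    (hπ : π = (Measure.pi fun _ : Edge d L => haarProbability G).withDensity fun U =>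
      ENNReal.ofReal ((∏ p : Plaquette d L, w (plaquetteHolonomy U p.1 p.2.1.1 p.2.1.2)) /
        ∫ V, ∏ p : Plaquette d L, w (plaquetteHolonomy V p.1 p.2.1.1 p.2.1.2)
          ∂(Measure.pi fun _ : Edge d L => haarProbability G)))
    (hq : q = (Measure.pi fun _ : Edge d L => haarProbability G).withDensity fun U =>
      ENNReal.ofReal ((∏ p ∈ B, w (plaquetteHolonomy U p.1 p.2.1.1 p.2.1.2)) /
        ∫ V, ∏ p ∈ B, w (plaquetteHolonomy V p.1 p.2.1.1 p.2.1.2)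
          ∂(Measure.pi fun _ : Edge d L => haarProbability G))) (n : ℕ) :
    (1 - (M₂ / M) ^ S.card) ^ n ≤
      ((fun ν : Measure (GaugeConfig d L G) => ν.bind (indepMH q fun U =>
        ((∫ V, ∏ p : Plaquette d L, w (plaquetteHolonomy V p.1 p.2.1.1 p.2.1.2)
            ∂(Measure.pi fun _ : Edge d L => haarProbability G)) /
          ((∫ V, ∏ p ∈ B, w (plaquetteHolonomy V p.1 p.2.1.1 p.2.1.2)
            ∂(Measure.pi fun _ : Edge d L => haarProbability G)) *
            ∏ p ∈ Finset.univ \ B, w (plaquetteHolonomy U p.1 p.2.1.1 p.2.1.2)))⁻¹))^[n]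
        (Measure.dirac (fun _ : Edge d L => (1 : G)))).real {fun _ : Edge d L => (1 : G)} := by
  set Haar : Measure (GaugeConfig d L G) := Measure.pi fun _ : Edge d L => haarProbability G with hHaar
  set FT : GaugeConfig d L G → ℝ := fun U => ∏ p : Plaquette d L, w (plaquetteHolonomy U p.1 p.2.1.1 p.2.1.2)
    with hFT
  set FB : GaugeConfig d L G → ℝ := fun U => ∏ p ∈ B, w (plaquetteHolonomy U p.1 p.2.1.1 p.2.1.2) with hFB
  set FR : GaugeConfig d L G → ℝ := fun U => ∏ p ∈ Finset.univ \ B, w (plaquetteHolonomy U p.1 p.2.1.1 p.2.1.2)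
    with hFR
  set ZT : ℝ := ∫ V, FT V ∂Haar with hZT
  set ZB : ℝ := ∫ V, FB V ∂Haar with hZB
  set k : ℕ := (Finset.univ \ B).card with hk
  set s : ℕ := S.card with hs
  set cold : GaugeConfig d L G := fun _ => (1 : G) with hcold
  have hw0 : ∀ g, 0 < w g := fun g => hm0.trans_le (hm g)
  have hMpos : 0 < M := (hw0 1).trans_le (hM 1)
  haveI : IsProbabilityMeasure Haar := by rw [hHaar]; infer_instance
  have hc : 0 < ∫ g, w g ∂(haarProbability G) := haarProbability_integral_pos_of_continuous_pos hw hw0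
  have hFTc : Continuous FT := continuous_prodPlaquetteWeight_anyDim hw Finset.univ
  have hFRc : Continuous FR := continuous_prodPlaquetteWeight_anyDim hw (Finset.univ \ B)
  have hFTpos : ∀ U, 0 < FT U := fun U => prod_pos fun p _ => hw0 _
  have hFBpos : ∀ U, 0 < FB U := fun U => prod_pos fun p _ => hw0 _
  have hFRpos : ∀ U, 0 < FR U := fun U => prod_pos fun p _ => hw0 _
  have hFRle : ∀ U, FR U ≤ M ^ k := fun U => (pow_le_prodPlaquetteWeight_le_pow_anyDim hm0 hm hM _ U).2
  have hsplit : ∀ U, FT U = FR U * FB U := fun U => (Finset.prod_sdiff (Finset.subset_univ B)).symm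
  have hint : ∀ {F : GaugeConfig d L G → ℝ}, Continuous F → (∀ U, 0 < F U) → ∀ K : ℝ, (∀ U, F U ≤ K) →
      Integrable F Haar := by
    intro F hF hF0 K hK
    refine Integrable.mono' (integrable_const K) hF.aestronglyMeasurable (ae_of_all _ fun U => ?_)
    rw [Real.norm_eq_abs, abs_of_pos (hF0 U)]; exact hK U
  have hFTi : Integrable FT Haar :=
    hint hFTc hFTpos (M ^ (Finset.univ : Finset (Plaquette d L)).card)
      fun U => (pow_le_prodPlaquetteWeight_le_pow_anyDim hm0 hm hM _ U).2
  have hFBc : Continuous FB := continuous_prodPlaquetteWeight_anyDim hw B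
  have hFBi : Integrable FB Haar :=
    hint hFBc hFBpos (M ^ B.card) fun U => (pow_le_prodPlaquetteWeight_le_pow_anyDim hm0 hm hM _ U).2
  have hZTpos : 0 < ZT := by
    have h := integral_mono (integrable_const (m ^ (Finset.univ : Finset (Plaquette d L)).card)) hFTi
      fun U => (pow_le_prodPlaquetteWeight_le_pow_anyDim hm0 hm hM _ U).1
    rw [integral_const, smul_eq_mul, probReal_univ, one_mul] at h
    exact lt_of_lt_of_le (pow_pos hm0 _) h
  have hZB' : ZB = (∫ g, w g ∂(haarProbability G)) ^ B.card :=
    integral_prod_weight_eq_pow_of_rank (G := G) hL hw hm0 hm hM B t ht rank hrank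
  have hZBpos : 0 < ZB := by rw [hZB']; exact pow_pos hc _
  -- `Z ≤ Z_B M^k` (the scorecard squeeze): the cold configuration has `ρ ≤ 1`
  have hZTle : ZT ≤ ZB * M ^ k := by
    calc ZT = ∫ V, FR V * FB V ∂Haar := by simp_rw [hZT, hsplit]
      _ ≤ ∫ V, M ^ k * FB V ∂Haar :=
          integral_mono_of_nonneg (ae_of_all _ fun V => (mul_pos (hFRpos V) (hFBpos V)).le)
            (hFBi.const_mul _) (ae_of_all _ fun V => mul_le_mul_of_nonneg_right (hFRle V) (hFBpos V).le)
      _ = ZB * M ^ k := by rw [integral_const_mul, hZB, mul_comm]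
  -- the density ratio and the kernel weight
  set ρ : GaugeConfig d L G → ℝ := fun U => ZT / (ZB * FR U) with hρ
  have hρpos : ∀ U, 0 < ρ U := fun U => div_pos hZTpos (mul_pos hZBpos (hFRpos U))
  have hρm : Measurable ρ := (continuous_const.div (continuous_const.mul hFRc)
    fun U => (mul_pos hZBpos (hFRpos U)).ne').measurable
  have hρq : q = π.withDensity fun U => ENNReal.ofReal (ρ U) := by
    rw [hq, hπ]
    change Haar.withDensity (fun U => ENNReal.ofReal (FB U / ZB)) =
      (Haar.withDensity fun U => ENNReal.ofReal (FT U / ZT)).withDensity fun U => ENNReal.ofReal (ρ U)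
    rw [← withDensity_mul _ (by fun_prop : Measurable fun U => ENNReal.ofReal (FT U / ZT))
      (by exact hρm.ennreal_ofReal)]
    refine withDensity_congr_ae (ae_of_all _ fun U => ?_)
    simp only [Pi.mul_apply]
    rw [← ENNReal.ofReal_mul (div_nonneg (hFTpos U).le hZTpos.le)]
    congr 1
    rw [hρ, hsplit U]
    field_simp [(hFRpos U).ne', hZBpos.ne', hZTpos.ne']
  have hπ' : (q.withDensity fun U => ENNReal.ofReal (ρ U)⁻¹) = π := withDensity_inv_density hρm hρpos hρq
  have hwm : Measurable fun U => (ρ U)⁻¹ := hρm.inv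
  have hw0' : ∀ U, 0 < (ρ U)⁻¹ := fun U => inv_pos.2 (hρpos U)
  have hone : ∫⁻ y, ENNReal.ofReal (ρ y)⁻¹ ∂q = ENNReal.ofReal 1 := by
    have h : π Set.univ = 1 := measure_univ
    rw [← hπ', withDensity_apply _ MeasurableSet.univ, Measure.restrict_univ] at h
    rw [h, ENNReal.ofReal_one]
  -- at the cold configuration: `F_R = M^k`, `ρ ≤ (M₂/M)^s` and `ρ ≤ 1`
  have hFRcold : FR cold = M ^ k := by rw [hFR, hcold]; simp only []; rw [prod_plaquetteWeight_cold, hw1]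
  have hacc := (closing_volumeFloor (G := G) hL hw hm0 hm hM hM₂ hM₂' B t ht rank hrank S u hSB huB hut
    humax huinj π q hπ hq).1 cold
  have hρcold : ρ cold ≤ (M₂ / M) ^ s := by
    have h1 : ρ cold ≤ (M₂ / M) ^ s * (M ^ k / FR cold) := by
      have hSsub : S ⊆ Finset.univ \ B := fun p' hp' => Finset.mem_sdiff.2 ⟨Finset.mem_univ _, hSB p' hp'⟩
      have hsk : s ≤ k := Finset.card_le_card hSsub
      have hdiv : ZT / ZB ≤ M ^ (k - s) * M₂ ^ s :=
        integral_prod_weight_div_le_of_closing (G := G) hL hw hm0 hm hM hM₂ hM₂' B t ht rank hrank S u hSB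
          huB hut humax huinj
      have hpow : M ^ (k - s) * M₂ ^ s = (M₂ / M) ^ s * M ^ k := by
        have h1 : M ^ k = M ^ (k - s) * M ^ s := by rw [← pow_add, Nat.sub_add_cancel hsk]
        have hMs : M ^ s ≠ 0 := pow_ne_zero _ hMpos.ne'
        rw [h1, div_pow]
        field_simp
      calc ρ cold = (ZT / ZB) / FR cold := by rw [hρ, div_div]
        _ ≤ (M ^ (k - s) * M₂ ^ s) / FR cold := div_le_div_of_nonneg_right hdiv (hFRpos cold).le
        _ = (M₂ / M) ^ s * (M ^ k / FR cold) := by rw [hpow, mul_div_assoc]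
    rwa [hFRcold, div_self (pow_ne_zero _ hMpos.ne'), mul_one] at h1
  have hρcold1 : (1 : ℝ) ≤ (ρ cold)⁻¹ := by
    rw [one_le_inv₀ (hρpos cold), hρ]
    show ZT / (ZB * FR cold) ≤ 1
    rw [hFRcold, div_le_one (mul_pos hZBpos (pow_pos hMpos _))]
    exact hZTle
  have hstick := indepMH_iterate_dirac_singleton_real_ge_pow (q := q) hwm hw0' zero_le_one hone cold
    hρcold1 n
  rw [one_div, inv_inv] at hstick
  have hM₂0 : 0 ≤ M₂ := by
    have h1 := hM₂ 1 1
    have h0 : 0 ≤ ∫ h, w h * w (1 * h * 1) ∂(haarProbability G) :=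
      integral_nonneg fun h => mul_nonneg (hw0 _).le (hw0 _).le
    exact (mul_nonneg_iff_of_pos_left hc).1 (h0.trans h1)
  have hbase : 1 - (M₂ / M) ^ s ≤ 1 - ρ cold := by linarith
  have hbase0 : 0 ≤ 1 - (M₂ / M) ^ s := by
    have : (M₂ / M) ^ s ≤ 1 := pow_le_one₀ (div_nonneg hM₂0 hMpos.le) ((div_le_one hMpos).2 hM₂M)
    linarith
  exact (pow_le_pow_left₀ hbase0 hbase n).trans hstick

/-! ## §2 The optimal structures of `(ℤ/L)^d`: a floor of order `(M/M₂)^{k_min/(2d−3)}` -/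

/-- **THE VOLUME LAW, LOWER HALF, EVERY DIMENSION.**  `L ≥ 2`; `w` continuous, `0 < m ≤ w ≤ M`; `M₂` a
two-plaquette constant of `w`.  There is an OPTIMAL ranked structure `(B, t, rank)` of `(ℤ/L)^d` —
`#Bᶜ = k_min(d, L) = (d−1)(d−2)/2·L^d + (d−1)`, the least possible (`TorusRankedMorseCount`) — and an
`s` with `k_min ≤ (2(d−1) − 1)·s` such that, for the target `π = (F/Z)·Haar^{⊗E}`, the block proposal
`q = (F_B/Z_B)·Haar^{⊗E}` and the exact sampler `K = indepMH q (Z_B F_R/Z)`: the acceptance mass from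
every `U` is `≤ (M₂/M)^s · M^{k_min}/F_R(U)`, and every event `A ⊆ {F_R > θ M^{k_min}}` (`θ > 0`) of
positive target probability has `τ_int(1_A − π(A)) ≥ 1/(π(A) + (M₂/M)^s/θ) − 1/2`. [ours] -/
theorem exists_optimal_volumeFloor (hL : 2 ≤ L) {w : G → ℝ} (hw : Continuous w) {m M : ℝ}
    (hm0 : 0 < m) (hm : ∀ g, m ≤ w g) (hM : ∀ g, w g ≤ M) {M₂ : ℝ}
    (hM₂ : ∀ a b : G, ∫ h, w h * w (a * h * b) ∂(haarProbability G) ≤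
      (∫ g, w g ∂(haarProbability G)) * M₂)
    (hM₂' : ∀ a b : G, ∫ h, w h * w (a * h⁻¹ * b) ∂(haarProbability G) ≤
      (∫ g, w g ∂(haarProbability G)) * M₂) :
    ∃ (B : Finset (Plaquette d L)) (t : Plaquette d L → Edge d L) (rank : Plaquette d L → ℕ) (s : ℕ),
      (∀ p ∈ B, t p ∈ ({(p.1, p.2.1.1), (p.1.shift p.2.1.1, p.2.1.2),
        (p.1.shift p.2.1.2, p.2.1.1), (p.1, p.2.1.2)} : Finset (Edge d L))) ∧
      (∀ p ∈ B, ∀ p' ∈ B, p ≠ p' → t p ∈ ({(p'.1, p'.2.1.1), (p'.1.shift p'.2.1.1, p'.2.1.2),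
        (p'.1.shift p'.2.1.2, p'.2.1.1), (p'.1, p'.2.1.2)} : Finset (Edge d L)) → rank p < rank p') ∧
      (Finset.univ \ B).card = (d - 1) * (d - 2) / 2 * L ^ d + (d - 1) ∧
      (Finset.univ \ B).card ≤ (2 * (d - 1) - 1) * s ∧
      ∀ (π q : Measure (GaugeConfig d L G)) [IsProbabilityMeasure π] [IsProbabilityMeasure q],
        π = ((Measure.pi fun _ : Edge d L => haarProbability G).withDensity fun U =>
          ENNReal.ofReal ((∏ p : Plaquette d L, w (plaquetteHolonomy U p.1 p.2.1.1 p.2.1.2)) /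
            ∫ V, ∏ p : Plaquette d L, w (plaquetteHolonomy V p.1 p.2.1.1 p.2.1.2)
              ∂(Measure.pi fun _ : Edge d L => haarProbability G))) →
        q = ((Measure.pi fun _ : Edge d L => haarProbability G).withDensity fun U =>
          ENNReal.ofReal ((∏ p ∈ B, w (plaquetteHolonomy U p.1 p.2.1.1 p.2.1.2)) /
            ∫ V, ∏ p ∈ B, w (plaquetteHolonomy V p.1 p.2.1.1 p.2.1.2)
              ∂(Measure.pi fun _ : Edge d L => haarProbability G))) →
        (∀ U : GaugeConfig d L G,
          (imhAcceptMass q (fun U =>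
            ((∫ V, ∏ p : Plaquette d L, w (plaquetteHolonomy V p.1 p.2.1.1 p.2.1.2)
                ∂(Measure.pi fun _ : Edge d L => haarProbability G)) /
              ((∫ V, ∏ p ∈ B, w (plaquetteHolonomy V p.1 p.2.1.1 p.2.1.2)
                ∂(Measure.pi fun _ : Edge d L => haarProbability G)) *
                ∏ p ∈ Finset.univ \ B, w (plaquetteHolonomy U p.1 p.2.1.1 p.2.1.2)))⁻¹) U).toReal ≤
            (M₂ / M) ^ s * (M ^ (Finset.univ \ B).card /
              ∏ p ∈ Finset.univ \ B, w (plaquetteHolonomy U p.1 p.2.1.1 p.2.1.2))) ∧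
        ∀ θ : ℝ, 0 < θ → ∀ A : Set (GaugeConfig d L G), MeasurableSet A →
          (∀ U ∈ A, θ * M ^ (Finset.univ \ B).card <
            ∏ p ∈ Finset.univ \ B, w (plaquetteHolonomy U p.1 p.2.1.1 p.2.1.2)) → 0 < π.real A →
          1 / (π.real A + (M₂ / M) ^ s / θ) - 1 / 2 ≤
            tauInt (fun n => autocov (indepMH q fun U =>
              ((∫ V, ∏ p : Plaquette d L, w (plaquetteHolonomy V p.1 p.2.1.1 p.2.1.2)
                  ∂(Measure.pi fun _ : Edge d L => haarProbability G)) /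
                ((∫ V, ∏ p ∈ B, w (plaquetteHolonomy V p.1 p.2.1.1 p.2.1.2)
                  ∂(Measure.pi fun _ : Edge d L => haarProbability G)) *
                  ∏ p ∈ Finset.univ \ B, w (plaquetteHolonomy U p.1 p.2.1.1 p.2.1.2)))⁻¹) π
                (fun U => A.indicator (fun _ => (1 : ℝ)) U - π.real A) n /
              autocov (indepMH q fun U =>
              ((∫ V, ∏ p : Plaquette d L, w (plaquetteHolonomy V p.1 p.2.1.1 p.2.1.2)
                  ∂(Measure.pi fun _ : Edge d L => haarProbability G)) /
                ((∫ V, ∏ p ∈ B, w (plaquetteHolonomy V p.1 p.2.1.1 p.2.1.2)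
                  ∂(Measure.pi fun _ : Edge d L => haarProbability G)) *
                  ∏ p ∈ Finset.univ \ B, w (plaquetteHolonomy U p.1 p.2.1.1 p.2.1.2)))⁻¹) π
                (fun U => A.indicator (fun _ => (1 : ℝ)) U - π.real A) 0) := by
  obtain ⟨B, t, rank, S, u, ht, hrank, hSB, huB, hut, humax, huinj, hk, hs⟩ :=
    exists_optimal_closingSection (d := d) (L := L) hL
  refine ⟨B, t, rank, S.card, ht, hrank, hk, hs, ?_⟩
  intro π q _ _ hπ hq
  exact closing_volumeFloor (G := G) hL hw hm0 hm hM hM₂ hM₂' B t ht rank hrank S u hSB huB hut humax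
    huinj π q hπ hq

/-- **`d = 3`: THE EXACT ONE-PLAQUETTE HEAT-BATH SAMPLER OF `(ℤ/L)³` IS EXPONENTIALLY SLOW IN THE
VOLUME.**  The optimal structure leaves `k_min = L³ + 2` plaquettes outside and has a closing section of
size `s` with `L³ + 2 ≤ 3s`; for its exact sampler the acceptance mass from `U` is
`≤ (M₂/M)^s · M^{L³+2}/F_R(U)` — at the cold configuration `≤ (M₂/M)^s ≤ (M₂/M)^{⌈(L³+2)/3⌉}` — and every
event `A ⊆ {F_R > θ M^{L³+2}}` of positive target probability has
`τ_int(1_A − π(A)) ≥ 1/(π(A) + (M₂/M)^s/θ) − 1/2`; the ceiling of `AutoregressiveGaugeHeatBathOptimal` is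
`(M/m)^{L³+2} − 1/2`. [ours] -/
theorem exists_optimal_volumeFloor_three (hL : 2 ≤ L) {w : G → ℝ} (hw : Continuous w) {m M : ℝ}
    (hm0 : 0 < m) (hm : ∀ g, m ≤ w g) (hM : ∀ g, w g ≤ M) {M₂ : ℝ}
    (hM₂ : ∀ a b : G, ∫ h, w h * w (a * h * b) ∂(haarProbability G) ≤
      (∫ g, w g ∂(haarProbability G)) * M₂)
    (hM₂' : ∀ a b : G, ∫ h, w h * w (a * h⁻¹ * b) ∂(haarProbability G) ≤
      (∫ g, w g ∂(haarProbability G)) * M₂) :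
    ∃ (B : Finset (Plaquette 3 L)) (t : Plaquette 3 L → Edge 3 L) (rank : Plaquette 3 L → ℕ) (s : ℕ),
      (∀ p ∈ B, t p ∈ ({(p.1, p.2.1.1), (p.1.shift p.2.1.1, p.2.1.2),
        (p.1.shift p.2.1.2, p.2.1.1), (p.1, p.2.1.2)} : Finset (Edge 3 L))) ∧
      (∀ p ∈ B, ∀ p' ∈ B, p ≠ p' → t p ∈ ({(p'.1, p'.2.1.1), (p'.1.shift p'.2.1.1, p'.2.1.2),
        (p'.1.shift p'.2.1.2, p'.2.1.1), (p'.1, p'.2.1.2)} : Finset (Edge 3 L)) → rank p < rank p') ∧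
      (Finset.univ \ B).card = L ^ 3 + 2 ∧ L ^ 3 + 2 ≤ 3 * s ∧
      ∀ (π q : Measure (GaugeConfig 3 L G)) [IsProbabilityMeasure π] [IsProbabilityMeasure q],
        π = ((Measure.pi fun _ : Edge 3 L => haarProbability G).withDensity fun U =>
          ENNReal.ofReal ((∏ p : Plaquette 3 L, w (plaquetteHolonomy U p.1 p.2.1.1 p.2.1.2)) /
            ∫ V, ∏ p : Plaquette 3 L, w (plaquetteHolonomy V p.1 p.2.1.1 p.2.1.2)
              ∂(Measure.pi fun _ : Edge 3 L => haarProbability G))) →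
        q = ((Measure.pi fun _ : Edge 3 L => haarProbability G).withDensity fun U =>
          ENNReal.ofReal ((∏ p ∈ B, w (plaquetteHolonomy U p.1 p.2.1.1 p.2.1.2)) /
            ∫ V, ∏ p ∈ B, w (plaquetteHolonomy V p.1 p.2.1.1 p.2.1.2)
              ∂(Measure.pi fun _ : Edge 3 L => haarProbability G))) →
        (∀ U : GaugeConfig 3 L G,
          (imhAcceptMass q (fun U =>
            ((∫ V, ∏ p : Plaquette 3 L, w (plaquetteHolonomy V p.1 p.2.1.1 p.2.1.2)
                ∂(Measure.pi fun _ : Edge 3 L => haarProbability G)) /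
              ((∫ V, ∏ p ∈ B, w (plaquetteHolonomy V p.1 p.2.1.1 p.2.1.2)
                ∂(Measure.pi fun _ : Edge 3 L => haarProbability G)) *
                ∏ p ∈ Finset.univ \ B, w (plaquetteHolonomy U p.1 p.2.1.1 p.2.1.2)))⁻¹) U).toReal ≤
            (M₂ / M) ^ s * (M ^ (L ^ 3 + 2) /
              ∏ p ∈ Finset.univ \ B, w (plaquetteHolonomy U p.1 p.2.1.1 p.2.1.2))) ∧
        ∀ θ : ℝ, 0 < θ → ∀ A : Set (GaugeConfig 3 L G), MeasurableSet A →
          (∀ U ∈ A, θ * M ^ (L ^ 3 + 2) <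
            ∏ p ∈ Finset.univ \ B, w (plaquetteHolonomy U p.1 p.2.1.1 p.2.1.2)) → 0 < π.real A →
          1 / (π.real A + (M₂ / M) ^ s / θ) - 1 / 2 ≤
            tauInt (fun n => autocov (indepMH q fun U =>
              ((∫ V, ∏ p : Plaquette 3 L, w (plaquetteHolonomy V p.1 p.2.1.1 p.2.1.2)
                  ∂(Measure.pi fun _ : Edge 3 L => haarProbability G)) /
                ((∫ V, ∏ p ∈ B, w (plaquetteHolonomy V p.1 p.2.1.1 p.2.1.2)
                  ∂(Measure.pi fun _ : Edge 3 L => haarProbability G)) *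
                  ∏ p ∈ Finset.univ \ B, w (plaquetteHolonomy U p.1 p.2.1.1 p.2.1.2)))⁻¹) π
                (fun U => A.indicator (fun _ => (1 : ℝ)) U - π.real A) n /
              autocov (indepMH q fun U =>
              ((∫ V, ∏ p : Plaquette 3 L, w (plaquetteHolonomy V p.1 p.2.1.1 p.2.1.2)
                  ∂(Measure.pi fun _ : Edge 3 L => haarProbability G)) /
                ((∫ V, ∏ p ∈ B, w (plaquetteHolonomy V p.1 p.2.1.1 p.2.1.2)
                  ∂(Measure.pi fun _ : Edge 3 L => haarProbability G)) *
                  ∏ p ∈ Finset.univ \ B, w (plaquetteHolonomy U p.1 p.2.1.1 p.2.1.2)))⁻¹) π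
                (fun U => A.indicator (fun _ => (1 : ℝ)) U - π.real A) 0) := by
  obtain ⟨B, t, rank, s, ht, hrank, hk, hs, hmain⟩ :=
    exists_optimal_volumeFloor (d := 3) (G := G) hL hw hm0 hm hM hM₂ hM₂'
  have e1 : (3 - 1) * (3 - 2) / 2 * L ^ 3 + (3 - 1) = L ^ 3 + 2 := by norm_num
  have e2 : 2 * (3 - 1) - 1 = 3 := by norm_num
  rw [e1] at hk
  rw [hk, e2] at hs
  refine ⟨B, t, rank, s, ht, hrank, hk, hs, ?_⟩
  intro π q _ _ hπ hq
  have h := hmain π q hπ hq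
  rw [hk] at h
  exact h

end Summit.Ventures.LatticeQCDFlow.Theory2.Autoregressive

end
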